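import Literature.Barriers.QuantumAdvantage.AaronsonChenLearning
import Literature.Computability.Learning.OccamFiniteProofs
import Literature.Computability.Cryptography.StatisticalDistanceMixtures
import Literature.Computability.Complexity.CircuitLowerBounds
import HarnessLib

/-!
# Aaronson–Chen 2017, Lemma 8.2: the analysis of the PAC-learning replacement process (proved)

Sibling of `AaronsonChenLearning.lean` (the process `AcLearn.process`, its bad event `badSet`,
the learner's law `learnLaw`, the hypothesis classes `hypClass`). This file PROVES the
probabilistic half of the printed proof of

* S. Aaronson, L. Chen, CCC 2017 (arXiv:1612.05903) [AaronsonChen2017], **Lemma 8.2**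
  (pp. 32–33),

for EVERY admissible selection rule, in the tree's models:

* `mem_occamBadEvent_of_lt_queryWeight` — **the Occam bridge**: if an admissible choice `g`
  (a language of `SIZE(q)` consistent with the `O`-labelled sample) errs with query magnitude
  `q_{[g ≠ O]}(ψ) > ε₁`, then the sample lies in the bad event of Occam's razor for the finite
  class `hypClass q k` under `Q = queryMarginal e ψ` (the tree's `Learning.occamBadEvent`; the
  query magnitude IS the `Q`-probability, `queryWeight_eq_toReal_queryMarginal`);
* `toOuterMeasure_badSet_le` — **the union bound along the adaptive process**: with `m` samples
  per gate, `Pr_process[some replaced gate errs by more than ε₁] ≤ T · δ` as soon as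
  `|hypClass q k| (1 − ε₁)^m ≤ δ` for every query width `k < N` ("by a standard result of PAC
  learning … with probability at least `1 − δ₁` … Then by a union bound over all rounds"), by
  induction on the gate list: conditionally on the past the samples are i.i.d. from the current
  `Q_t` (`Learning.occam_uniform_bound_holds`), and the future is the process from the replaced
  state;
* `tvDist_kernel_learnLaw_le` — **"the bad event costs its probability"**:
  `Δ(𝒟^M, learnLaw) ≤ T·δ + 2T√ε₁` (`PMF.tvDist_bind_right_le_of_good` with, on the good event,
  the replacement toolkit's `tvDist_kernel_replKernel_le_of_forall_le`);
* (in `PPolyOraclesLemma82.lean`) `exists_budget_tvDist_kernel_learnLaw_le` — **the polynomial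
  budget**: for every family `F` over a unitary gate set and every `q` there is `c` such that with
  `m = (N + T + 2)^c` samples per gate, for every admissible rule, every `O ∈ SIZE(q)`, every
  post-processing and every input `w` with `k ≤ |w|`, `Δ(𝒟^M, learnLaw) ≤ 1/2k` (the paper's
  `δ₁ = ε/2T`, `ε₁ = ε⁴/256T²`; here `√ε₁ = 1/8M²`, `δ = 1/4M²`, `M = N + T + 2`, and
  `c = 3d + 15` for `q(n) ≤ (n + 2)^d`, using `ln |hypClass q k| ≤ (N + q(N) + 3)(q(N) + 4)² ln 2`)
  — this last step is assembled in `PPolyOraclesLemma82.lean`; the elementary inequalities it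
  needs (`natPoly_exists_le_pow`, `exponent_le_pow`, `budget_mul_le_pow`,
  `two_pow_mul_exp_neg_le`, `one_sub_pow_le_exp_neg`) close this file.

## Design notes

* Constants. The tree's sampling classes fix `ε = 1/k`; the target here is `1/2k`, leaving `1/2k`
  to the machine (as in `aaronsonChen2017_lem53_machine`). Measuring unit vectors at `ℓ²`-distance
  `η` moves Born laws by `≤ η` (Bernstein–Vazirani form), so no square root of Cor. 2.5 appears.
* Probabilities are handled in `ℝ≥0∞` through `PMF.toOuterMeasure` (`toOuterMeasure_bind_apply`,
  `toOuterMeasure_map_apply`); the three `tsum` helper lemmas are the only bookkeeping.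

## Sources

* [AaronsonChen2017] arXiv:1612.05903, pp. 32–33 (proof of Lemma 8.2), read via
  `lit read arxiv:1612.05903`.
* [MohriRostamizadehTalwalkar2018] Thm. 2.5 (Occam's razor for a finite class), as proved in the
  tree: `Literature/Computability/Learning/OccamFiniteProofs.lean`.
* [Goldreich2001] §3.8.4 Exercise 5 (events vs. statistical distance), as proved in the tree:
  `Literature/Computability/Cryptography/StatisticalDistanceMixtures.lean`.
-/

noncomputable section

namespace Literature.Barriers.QuantumAdvantage

open _root_.Computability Literature.Computability.Complexity Literature.Computability.Cryptography
  Literature.Computability.QuantumComplexity Literature.Computability.Learning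
open Matrix
open scoped ENNReal

variable {G : QGateSet} {N k : ℕ}

namespace AcLearn

/-! ### The Occam bridge -/

/-- The query-register law is supported on strings of the query width: events may be changed off
that length. [folklore] -/
theorem toOuterMeasure_queryMarginal_congr (e : Fin (k + 1) ↪ Fin N) (ψ : QReg N → ℂ)
    {D D' : Set (List Bool)} (h : ∀ w : List Bool, w.length = k → (w ∈ D ↔ w ∈ D')) :
    (queryMarginal e ψ).toOuterMeasure D = (queryMarginal e ψ).toOuterMeasure D' := by
  rw [queryMarginal, PMF.toOuterMeasure_map_apply, PMF.toOuterMeasure_map_apply]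
  congr 1
  ext x
  simp only [Set.mem_preimage]
  exact h _ (by simp [queryOf])

/-- **The Occam bridge.** At an oracle gate with query wires `e` in the unit state `ψ`, let
`Q = queryMarginal e ψ`. If `g ∈ SIZE(q)` is consistent with the `O`-labelled sample `S` and yet
`Pr_{i∼Q}[[i ∈ g] ≠ [i ∈ O]] = q_{[g ≠ O]}(ψ) > ε₁`, then `S` lies in the bad event of Occam's
razor for the class `hypClass q k`, the target `hyp O k` and accuracy `ε₁`: the slice `hyp g k`
is a hypothesis of the class, consistent with the target on `S`, of generalisation error `> ε₁`.
[cite: AaronsonChen2017, §8 (proof of Lemma 8.2, "By a standard result of PAC learning … find a function g in SIZE(q(n)) which agrees with f on those samples. Then with probability at least 1 − δ₁, we will have Pr_{i∼Q}[f(i) ≠ g(i)] ≤ ε₁", p. 33)] -/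
theorem mem_occamBadEvent_of_lt_queryWeight {q : Polynomial ℕ} {O g : Language Bool}
    (hg : g ∈ SIZE (fun n => q.eval n)) (e : Fin (k + 1) ↪ Fin N) {ψ : QReg N → ℂ}
    (hψ : normSq ψ = 1) {S : List (List Bool)} (hcons : Consistent g (label O S)) {ε₁ : ℝ}
    (hε₁ : 0 ≤ ε₁) (hlt : ε₁ < queryWeight (disagree₁ g O) e ψ) :
    S ∈ occamBadEvent (queryMarginal e ψ) (hyp O k) (hypClass q k) ε₁ := by
  refine ⟨hyp g k, hyp_mem_hypClass hg k, fun w hw => ?_, ?_⟩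
  · unfold hyp
    by_cases h : w.length = k
    · rw [if_pos h, if_pos h]
      exact (consistent_label_iff g O S).1 hcons w hw
    · rw [if_neg h, if_neg h]
  · have hc : ∀ w : List Bool, w.length = k →
        (w ∈ {w | hyp g k w ≠ hyp O k w} ↔ w ∈ disagree₁ g O) := fun w hw => by
      simp [hyp, hw, disagree₁]
    unfold genError
    rw [toOuterMeasure_queryMarginal_congr e ψ hc]
    rw [queryWeight_eq_toReal_queryMarginal hψ] at hlt
    have hle : (queryMarginal e ψ).toOuterMeasure (disagree₁ g O) ≤ 1 :=
      ((queryMarginal e ψ).toOuterMeasure_mono (Set.inter_subset_right.trans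
        (Set.subset_univ _))).trans_eq (((queryMarginal e ψ).toOuterMeasure_apply_eq_one_iff
          _).2 (Set.subset_univ _))
    exact (ENNReal.ofReal_lt_iff_lt_toReal hε₁ (hle.trans_lt ENNReal.one_lt_top).ne).2 hlt

/-! ### Bookkeeping: three sums against a `PMF` -/

/-- `∑ₓ p(x) (a(x) + b) = ∑ₓ p(x) a(x) + b`. [folklore] -/
theorem tsum_coe_mul_add_const {α : Type*} (p : PMF α) (a : α → ℝ≥0∞) (b : ℝ≥0∞) :
    ∑' x, p x * (a x + b) = ∑' x, p x * a x + b := by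
  simp only [mul_add]
  rw [ENNReal.tsum_add, ENNReal.tsum_mul_right, p.tsum_coe, one_mul]

/-- An average of quantities bounded by `b` on the support is at most `b`. [folklore] -/
theorem tsum_coe_mul_le_const {α : Type*} (p : PMF α) {a : α → ℝ≥0∞} {b : ℝ≥0∞}
    (h : ∀ x ∈ p.support, a x ≤ b) : ∑' x, p x * a x ≤ b := by
  calc ∑' x, p x * a x ≤ ∑' x, p x * b := ENNReal.tsum_le_tsum fun x => by
        by_cases hx : x ∈ p.support
        · exact mul_le_mul' le_rfl (h x hx)
        · rw [(p.apply_eq_zero_iff x).2 hx, zero_mul, zero_mul]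
    _ = b := by rw [ENNReal.tsum_mul_right, p.tsum_coe, one_mul]

/-- The average of the indicator of an event is its probability. [folklore] -/
theorem tsum_coe_mul_indicator {α : Type*} (p : PMF α) (s : Set α) [DecidablePred (· ∈ s)] :
    ∑' x, p x * (if x ∈ s then 1 else 0) = p.toOuterMeasure s := by
  rw [PMF.toOuterMeasure_apply]
  exact tsum_congr fun x => by
    by_cases hx : x ∈ s
    · rw [if_pos hx, mul_one, Set.indicator_of_mem hx]
    · rw [if_neg hx, mul_zero, Set.indicator_of_notMem hx]

/-! ### The probability of the bad event: Occam per gate, union bound along the process -/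

/-- **With probability at least `1 − T·δ` every replaced gate errs by at most `ε₁`.** Over a
unitary gate set, for an admissible rule, an oracle `O ∈ SIZE(q)`, `m` samples per gate,
`0 < ε₁ ≤ 1`, and `δ` with `|hypClass q k| (1 − ε₁)^m ≤ δ` for every query width `k < N`: from
every unit state `ψ` and counter `i`, the process along `gs` hits the bad event with probability
at most `T · δ`, `T` the number of oracle gates of `gs`. Induction on `gs`: at an oracle gate the
law is `S ∼ Q^m`, then `g ∼ sel(S)`, then the process from `U_g ψ`; by `mem_badSet_cons_oracle`
the bad event needs `q_{[g ≠ O]}(ψ) > ε₁` — which for the admissible (consistent, `SIZE(q)`) `g`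
puts `S` in Occam's bad event (`mem_occamBadEvent_of_lt_queryWeight`), of `Q^m`-probability
`≤ |H|(1 − ε₁)^m ≤ δ` (`occam_uniform_bound_holds`) — or the bad event from `U_g ψ` on,
of probability `≤ T'·δ` by induction, uniformly in `g`.
[cite: AaronsonChen2017, §8 (proof of Lemma 8.2, "Now we set δ₁ = ε/2T … Then by a union bound over all rounds … with probability at least 1 − T·δ₁", p. 33)] -/
theorem toOuterMeasure_badSet_le (hG : G.IsUnitary) {q : Polynomial ℕ} {sel : SelRule}
    (hsel : Admissible q sel) {O : Language Bool} (hO : O ∈ SIZE (fun n => q.eval n)) (m : ℕ)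
    {ε₁ : ℝ} (hε₁ : 0 < ε₁) (hε₁' : ε₁ ≤ 1) {δ : ℝ≥0∞}
    (hδ : ∀ k : ℕ, k < N → ((hypClass q k).card : ℝ≥0∞) * ENNReal.ofReal ((1 - ε₁) ^ m) ≤ δ)
    (i : ℕ) (gs : List (QGate G N)) (ψ : QReg N → ℂ) (hψ : normSq ψ = 1) :
    (process sel O m i gs ψ).toOuterMeasure (badSet O ε₁ i gs ψ) ≤
      ((⟨gs⟩ : QCircuit G N).oracleQueries : ℝ≥0∞) * δ := by
  classical
  induction gs generalizing i ψ with
  | nil =>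
    have h0 : badSet O ε₁ i ([] : List (QGate G N)) ψ = ∅ := by
      ext g
      simp [badSet]
    rw [h0]
    simp
  | cons x gs ih =>
    cases x with
    | gate s e =>
      have hT : (⟨QGate.gate s e :: gs⟩ : QCircuit G N).oracleQueries =
          (⟨gs⟩ : QCircuit G N).oracleQueries := by
        unfold QCircuit.oracleQueries
        rw [List.filter_cons_of_neg (by simp [QGate.IsOracleFree])]
      rw [process_cons_gate, badSet_cons_gate, hT]
      refine ih i _ ?_
      rw [normSq_mulVec_of_mem_unitaryGroup (placeGate_mem_unitaryGroup_holds e (hG s)), hψ]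
    | oracle kq e =>
      have hkq : kq < N := by
        have := Fintype.card_le_of_embedding e
        simp only [Fintype.card_fin] at this
        omega
      have hunit : ∀ g : Language Bool, normSq (placeGate e (oracleGate g kq) *ᵥ ψ) = 1 :=
        fun g => by
          rw [normSq_mulVec_of_mem_unitaryGroup
            (placeGate_mem_unitaryGroup_holds e (oracleGate_mem_unitaryGroup_holds _ kq)), hψ]
      -- one selected `g`: either it errs now, or the future is bad
      have hinner : ∀ g : Language Bool,
          ((process sel O m (i + 1) gs (placeGate e (oracleGate g kq) *ᵥ ψ)).map
              fun rest => Function.update rest i g).toOuterMeasure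
              (badSet O ε₁ i (QGate.oracle kq e :: gs) ψ) ≤
            (if ε₁ < queryWeight (disagree₁ g O) e ψ then 1 else 0) +
              ((⟨gs⟩ : QCircuit G N).oracleQueries : ℝ≥0∞) * δ := by
        intro g
        rw [PMF.toOuterMeasure_map_apply]
        by_cases hlt : ε₁ < queryWeight (disagree₁ g O) e ψ
        · rw [if_pos hlt]
          exact le_add_right ((PMF.toOuterMeasure_mono _ (Set.inter_subset_right.trans
            (Set.subset_univ _))).trans_eq ((PMF.toOuterMeasure_apply_eq_one_iff _ _).2
              (Set.subset_univ _)))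
        · rw [if_neg hlt, zero_add]
          refine (PMF.toOuterMeasure_mono _ ?_).trans (ih (i + 1) _ (hunit g))
          rintro rest ⟨hrest, -⟩
          rw [Set.mem_preimage] at hrest
          exact (mem_badSet_cons_oracle hrest).resolve_left hlt
      -- average over the selected `g`: admissibility and the Occam bridge
      have hmid : ∀ S : List (List Bool),
          ((sel i kq (label O S)).bind fun g =>
              (process sel O m (i + 1) gs (placeGate e (oracleGate g kq) *ᵥ ψ)).map
                fun rest => Function.update rest i g).toOuterMeasure
              (badSet O ε₁ i (QGate.oracle kq e :: gs) ψ) ≤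
            (if S ∈ occamBadEvent (queryMarginal e ψ) (hyp O kq) (hypClass q kq) ε₁ then 1
              else 0) + ((⟨gs⟩ : QCircuit G N).oracleQueries : ℝ≥0∞) * δ := by
        intro S
        rw [PMF.toOuterMeasure_bind_apply]
        refine (ENNReal.tsum_le_tsum fun g => mul_le_mul' le_rfl (hinner g)).trans ?_
        rw [tsum_coe_mul_add_const]
        refine add_le_add (tsum_coe_mul_le_const _ fun g hg => ?_) le_rfl
        by_cases hS : S ∈ occamBadEvent (queryMarginal e ψ) (hyp O kq) (hypClass q kq) ε₁
        · rw [if_pos hS]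
          split_ifs <;> simp
        · rw [if_neg hS]
          have hadm := hsel i kq (label O S) ⟨O, hO, consistent_label O S⟩ g hg
          rw [if_neg fun hlt => hS
            (mem_occamBadEvent_of_lt_queryWeight hadm.1 e hψ hadm.2 hε₁.le hlt)]
      -- average over the samples: Occam's razor
      have hsplit : (((⟨QGate.oracle kq e :: gs⟩ : QCircuit G N).oracleQueries : ℕ) : ℝ≥0∞) * δ =
          δ + ((⟨gs⟩ : QCircuit G N).oracleQueries : ℝ≥0∞) * δ := by
        have hT : (⟨QGate.oracle kq e :: gs⟩ : QCircuit G N).oracleQueries =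
            (⟨gs⟩ : QCircuit G N).oracleQueries + 1 := by
          unfold QCircuit.oracleQueries
          rw [List.filter_cons_of_pos (by simp [QGate.IsOracleFree]), List.length_cons]
        rw [hT, Nat.cast_add, Nat.cast_one, add_mul, one_mul, add_comm]
      rw [hsplit, process_cons_oracle]
      rw [PMF.toOuterMeasure_bind_apply]
      refine (ENNReal.tsum_le_tsum fun S => mul_le_mul' le_rfl (hmid S)).trans ?_
      rw [tsum_coe_mul_add_const, tsum_coe_mul_indicator]
      exact add_le_add
        ((occam_uniform_bound_holds (queryMarginal e ψ) (hyp O kq) (hypClass q kq) ε₁ hε₁ hε₁'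
          m).trans (hδ kq hkq)) le_rfl

/-! ### The distance of the learner's law to the truth -/

/-- **`Δ(𝒟^M, 𝒟^A_ideal) ≤ T·δ + 2T√ε₁`.** Over a unitary gate set, for an admissible rule, an
oracle `O ∈ SIZE(q)`, `m` samples per gate, `0 < ε₁ ≤ 1`, `0 ≤ δ` with
`|hypClass q k| (1 − ε₁)^m ≤ δ` for all `k < N` (`N` the number of wires): the post-processed
kernel of `F` at `O` on input `w` and the learner's law are within `T·δ + 2T√ε₁` — the bad event
costs its probability `T·δ` (`toOuterMeasure_badSet_le`), and on the good event the replaced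
kernel is within `2T√ε₁` (`tvDist_kernel_replKernel_le_of_forall_le`), combined by
`PMF.tvDist_bind_right_le_of_good`. [cite: AaronsonChen2017, §8 (proof of Lemma 8.2, "with probability at least 1 − ε/2, the final distribution 𝒟 … satisfies ‖𝒟 − 𝒟^M_{x,ε}‖ ≤ ε/2. Hence, the outputted distribution 𝒟^A_{x,ε} satisfies ‖𝒟^A_{x,ε} − 𝒟^M_{x,ε}‖ ≤ ε", p. 33)] -/
theorem tvDist_kernel_learnLaw_le (hG : G.IsUnitary) {q : Polynomial ℕ} {sel : SelRule}
    (hsel : Admissible q sel) {O : Language Bool} (hO : O ∈ SIZE (fun n => q.eval n)) (m : ℕ)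
    {ε₁ : ℝ} (hε₁ : 0 < ε₁) (hε₁' : ε₁ ≤ 1) {δ : ℝ} (hδ0 : 0 ≤ δ) (F : QCircuitFamily G)
    (post : List Bool → List Bool) (w : List Bool)
    (hδ : ∀ k : ℕ, k < w.length + F.ancillas w.length →
      ((hypClass q k).card : ℝ) * (1 - ε₁) ^ m ≤ δ) :
    ((F.kernel O w).map post).tvDist (learnLaw sel O m F post w) ≤
      ((F.circ w.length).oracleQueries : ℝ) * δ +
        2 * ((F.circ w.length).oracleQueries : ℝ) * Real.sqrt ε₁ := by
  set ψ₀ : QReg (w.length + F.ancillas w.length) → ℂ :=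
    basisState (padInput w.get (F.ancillas w.length)) with hψ₀
  have hunit : normSq ψ₀ = 1 := normSq_basisState _
  set T := (F.circ w.length).oracleQueries with hT
  have hbadE : (process sel O m 0 (F.circ w.length).gates ψ₀).toOuterMeasure
      (badSet O ε₁ 0 (F.circ w.length).gates ψ₀) ≤ (T : ℝ≥0∞) * ENNReal.ofReal δ := by
    refine toOuterMeasure_badSet_le hG hsel hO m hε₁ hε₁' (fun kq hkq => ?_) 0 _ ψ₀ hunit
    rw [← ENNReal.ofReal_natCast, ← ENNReal.ofReal_mul (Nat.cast_nonneg _)]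
    exact ENNReal.ofReal_le_ofReal (hδ kq hkq)
  have hbad : ((process sel O m 0 (F.circ w.length).gates ψ₀).toOuterMeasure
      (badSet O ε₁ 0 (F.circ w.length).gates ψ₀)ᶜᶜ).toReal ≤ (T : ℝ) * δ := by
    rw [compl_compl]
    refine ENNReal.toReal_le_of_le_ofReal (by positivity) (hbadE.trans_eq ?_)
    rw [ENNReal.ofReal_mul (Nat.cast_nonneg _), ENNReal.ofReal_natCast]
  have hgood : ∀ g ∈ (badSet O ε₁ 0 (F.circ w.length).gates ψ₀)ᶜ,
      ((F.kernel O w).map post).tvDist ((replKernel g F w).map post) ≤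
        2 * (T : ℝ) * Real.sqrt ε₁ := fun g hg =>
    tvDist_kernel_replKernel_le_of_forall_le hG
      (fun t w' hw' => iff_of_notMem_disagree g O t w' hw') F w post
      ((not_mem_badSet_iff O ε₁ 0 _ ψ₀ g).1 hg)
  exact PMF.tvDist_bind_right_le_of_good _ _ _ _ (by positivity) hbad hgood

/-! ### Arithmetic for the polynomial budget (used by `PPolyOraclesLemma82.lean`) -/

/-- Every polynomial over `ℕ` is below `(n + 2)^d` for some `d ≥ 2`. [folklore] -/
theorem natPoly_exists_le_pow (q : Polynomial ℕ) : ∃ d : ℕ, 2 ≤ d ∧ ∀ n, q.eval n ≤ (n + 2) ^ d := by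
  set a := q.eval 1 with ha
  set D := q.natDegree with hD
  refine ⟨a + D + 2, by omega, fun n => ?_⟩
  have h2a : a ≤ 2 ^ a := Nat.lt_two_pow_self.le
  rcases Nat.eq_zero_or_pos n with rfl | hn
  · calc q.eval 0 ≤ q.eval 1 := natPoly_eval_mono q (Nat.zero_le 1)
      _ ≤ 2 ^ a := h2a
      _ ≤ (0 + 2) ^ (a + D + 2) := by
          rw [Nat.zero_add]
          exact Nat.pow_le_pow_right (by norm_num) (by omega)
  · calc q.eval n ≤ a * n ^ D := natPoly_eval_le_eval_one_mul_pow q hn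
      _ ≤ (n + 2) ^ a * (n + 2) ^ D :=
          Nat.mul_le_mul (h2a.trans (Nat.pow_le_pow_left (by omega) a))
            (Nat.pow_le_pow_left (by omega) D)
      _ = (n + 2) ^ (a + D) := (pow_add _ _ _).symm
      _ ≤ (n + 2) ^ (a + D + 2) := Nat.pow_le_pow_right (by omega) (by omega)

/-- The exponent of the hypothesis-class bound is polynomial: for `M ≥ 2`, `d ≥ 2`, `N ≤ M`,
`s ≤ M^d`, `(N + s + 3)(s + 4)² ≤ M^{3d+4}`. [folklore] -/
theorem exponent_le_pow {M d N s : ℕ} (hM : 2 ≤ M) (hd : 2 ≤ d) (hN : N ≤ M) (hs : s ≤ M ^ d) :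
    (N + s + 3) * (s + 4) ^ 2 ≤ M ^ (3 * d + 4) := by
  have hMd : M ≤ M ^ d := Nat.le_self_pow (by omega) M
  have hM2 : 4 ≤ M ^ 2 := by nlinarith
  have hM2d : M ^ 2 ≤ M ^ d := Nat.pow_le_pow_right (by omega) hd
  have h1 : N + s + 3 ≤ M ^ (d + 2) := by
    calc N + s + 3 ≤ M ^ d + M ^ d + M ^ d := by omega
      _ = 3 * M ^ d := by ring
      _ ≤ M ^ 2 * M ^ d := Nat.mul_le_mul_right _ (by omega)
      _ = M ^ (d + 2) := by ring
  have h2 : s + 4 ≤ M ^ (d + 1) := by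
    calc s + 4 ≤ M ^ d + M ^ d := by omega
      _ = 2 * M ^ d := by ring
      _ ≤ M * M ^ d := Nat.mul_le_mul_right _ hM
      _ = M ^ (d + 1) := by ring
  calc (N + s + 3) * (s + 4) ^ 2 ≤ M ^ (d + 2) * (M ^ (d + 1)) ^ 2 :=
        Nat.mul_le_mul h1 (Nat.pow_le_pow_left h2 2)
    _ = M ^ (3 * d + 4) := by
        rw [← pow_mul, ← pow_add]
        ring_nf

/-- The budget dominates: `64 M⁴ (E + 2M + 2) ≤ M^{3d+15}` when `E ≤ M^{3d+4}`, `M ≥ 2`. [folklore] -/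
theorem budget_mul_le_pow {M d E : ℕ} (hM : 2 ≤ M) (hE : E ≤ M ^ (3 * d + 4)) :
    64 * M ^ 4 * (E + 2 * M + 2) ≤ M ^ (3 * d + 15) := by
  have hM3 : 2 * M + 2 ≤ M ^ 3 := by
    have : 3 * M ≤ M ^ 3 := by
      calc 3 * M ≤ M * M * M := by nlinarith
        _ = M ^ 3 := by ring
    omega
  have hpow : M ^ 3 ≤ M ^ (3 * d + 4) := Nat.pow_le_pow_right (by omega) (by omega)
  have h64 : 64 ≤ M ^ 6 := by
    calc 64 = 2 ^ 6 := by norm_num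
      _ ≤ M ^ 6 := Nat.pow_le_pow_left hM 6
  have hsum : E + 2 * M + 2 ≤ M ^ (3 * d + 5) := by
    calc E + 2 * M + 2 ≤ M ^ (3 * d + 4) + M ^ (3 * d + 4) := by omega
      _ = 2 * M ^ (3 * d + 4) := by ring
      _ ≤ M * M ^ (3 * d + 4) := Nat.mul_le_mul_right _ hM
      _ = M ^ (3 * d + 5) := by ring
  calc 64 * M ^ 4 * (E + 2 * M + 2) ≤ M ^ 6 * M ^ 4 * M ^ (3 * d + 5) :=
        Nat.mul_le_mul (Nat.mul_le_mul_right _ h64) hsum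
    _ = M ^ (3 * d + 15) := by ring

/-- `2^E e^{−t} ≤ 1/4M²` once `t ≥ E + 2M + 2` (`e ≥ 2`, `4^M ≥ M²`; `M ≥ 1`). [folklore] -/
theorem two_pow_mul_exp_neg_le {E M : ℕ} (hM : 1 ≤ M) {t : ℝ} (ht : ((E + 2 * M + 2 : ℕ) : ℝ) ≤ t) :
    (2 : ℝ) ^ E * Real.exp (-t) ≤ 1 / (4 * (M : ℝ) ^ 2) := by
  have h2e : (2 : ℝ) ≤ Real.exp 1 := by
    have := Real.add_one_le_exp (1 : ℝ)
    linarith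
  have hn : Real.exp (-t) ≤ ((2 : ℝ) ^ (E + 2 * M + 2))⁻¹ := by
    rw [Real.exp_neg]
    refine inv_anti₀ (by positivity) ?_
    calc (2 : ℝ) ^ (E + 2 * M + 2) ≤ (Real.exp 1) ^ (E + 2 * M + 2) :=
          pow_le_pow_left₀ (by norm_num) h2e _
      _ = Real.exp ((E + 2 * M + 2 : ℕ) : ℝ) := by
          rw [← Real.exp_one_pow]
      _ ≤ Real.exp t := Real.exp_le_exp.2 ht
  have hM2 : ((M : ℝ)) ^ 2 ≤ (4 : ℝ) ^ M := by
    have h := (Nat.lt_two_pow_self (n := M)).le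
    have h' : (M : ℝ) ≤ (2 : ℝ) ^ M := by exact_mod_cast h
    calc ((M : ℝ)) ^ 2 ≤ ((2 : ℝ) ^ M) ^ 2 := pow_le_pow_left₀ (Nat.cast_nonneg _) h' 2
      _ = (4 : ℝ) ^ M := by rw [← pow_mul, Nat.mul_comm, pow_mul]; norm_num
  have hMpos : (0 : ℝ) < (M : ℝ) ^ 2 := by positivity
  calc (2 : ℝ) ^ E * Real.exp (-t) ≤ (2 : ℝ) ^ E * ((2 : ℝ) ^ (E + 2 * M + 2))⁻¹ :=
        mul_le_mul_of_nonneg_left hn (by positivity)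
    _ = 1 / (4 * (4 : ℝ) ^ M) := by
        rw [pow_add, pow_add, pow_mul]
        field_simp
        norm_num
    _ ≤ 1 / (4 * (M : ℝ) ^ 2) := by
        apply one_div_le_one_div_of_le (by positivity)
        linarith

/-- `(1 − ε)^m ≤ e^{−εm}` for `ε ≤ 1`. [folklore] -/
theorem one_sub_pow_le_exp_neg {ε : ℝ} (hε1 : ε ≤ 1) (m : ℕ) :
    (1 - ε) ^ m ≤ Real.exp (-(ε * m)) := by
  calc (1 - ε) ^ m ≤ (Real.exp (-ε)) ^ m := by
        apply pow_le_pow_left₀ (by linarith)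
        have := Real.add_one_le_exp (-ε)
        linarith
    _ = Real.exp (-(ε * m)) := by rw [← Real.exp_nat_mul]; ring_nf

end AcLearn

end Literature.Barriers.QuantumAdvantage

end
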